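import Summits.Langlands.Langlands.Theses.QuadraticWindow
import Literature.NumberTheory.GaloisRepresentations.SatakeFamilyOfFramedGaloisRep
import Literature.NumberTheory.GaloisRepresentations.CompactImageCharpolyIntegral
import Literature.AlgebraicGeometry.Motives.ZarhinHodgeGroupAutC
import Literature.FieldTheory.AlgClosed.PadicAlgClEquivComplex
import HarnessLib

/-!
# `GaloisRepOfUnitaryLDS` (stmt-Langlands-15129) — negative knowledge I: the hidden content of the
# conclusion (Satake rigidity, `ℓ`-adic unitarity, algebraicity)

Support lemmas of the standing disprover (`Cruxes/GaloisRepOfUnitaryLDS/Disproof.lean`, cycle 1,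
§2).  The crux `Summit.Langlands.Langlands.Theses.QuadraticWindow.GaloisRepOfUnitaryLDS`
(= `GoldringKoskivirta2019_galoisRep_unitary`, Goldring–Koskivirta 2019 Thm. 3.5.5 for Mok's
`U_{K/F₀}(N)`) concludes, for EVERY `ι : ℚ̄_ℓ ≃+* ℂ` and EVERY base-change Satake parameter `β` of
`σ` at a controlled place `u`, that ONE semisimple `r` has Frobenius polynomial
`arithFrobPolyOfSatake ι q_u N β` there.  Three automorphic statements follow FORMALLY from that
shape; each is a necessary target of any proof and a sufficient lever of any disproof, and none is
recorded elsewhere in the tree: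

* `galoisRepOfUnitaryLDS_satakeRigidity` — base-change Satake multisets at controlled places are
  UNIQUE (multiplicity one of the hyperspecial eigencharacter; in print Cartier 1979 §IV, Mínguez
  2011 Thm. 4.1 + irreducibility); refutation shape `galoisRepOfUnitaryLDS_false_of_satakeAmbiguity`.
* `galoisRepOfUnitaryLDS_satakeIntegrality` — for EVERY `ι`, `ι⁻¹(q_u^{(N-1)/2} b)` is an `ℓ`-adic
  unit for every `b ∈ β` (tool: `norm_eq_one_of_isRoot_charpoly`, eigenvalues of a compact-image
  representation over a normed field are units — the tree had `≤ 1` only).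
* `galoisRepOfUnitaryLDS_satakeAlgebraicity` — every `b ∈ β` is ALGEBRAIC over `ℚ` (tools:
  `exists_ringEquiv_complex_apply_eq`, `Aut(ℂ)` is transitive on transcendentals, from the tree's
  `ZarhinLie.exists_ringEquiv_complex_comp_eq`; `isAlgebraic_of_forall_norm_symm_eq_one`).  In print
  this is Goldring–Koskivirta Cor. 2.2.2 / Harris 1990 (rationality of coherent cohomology) — deep
  for IRREGULAR `σ`; refutation shape `galoisRepOfUnitaryLDS_false_of_transcendentalSatake`: ONE
  transcendental base-change Satake entry of ONE non-degenerate-LDS cusp form at ONE controlled place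
  refutes the crux as typed.

Nothing here asserts a route statement.  Mathlib + accepted tree only. [folklore]
-/

noncomputable section

-- single-conjunct summit `Summits/Langlands/Langlands` (D-0017): the doubled namespace is the tree's layout
set_option linter.dupNamespace false

open scoped Polynomial Classical NumberField MatrixGroups Matrix
open Polynomial IsDedekindDomain NumberField
open Literature.NumberTheory.Automorphic Literature.NumberTheory.GaloisRepresentations
open Summit.Langlands.Langlands.Theses.QuadraticWindow (GaloisRepOfUnitaryLDS)

namespace Summit.Langlands.Langlands.Theorems.GaloisRepOfUnitaryLDS.Negative

/-! ## Tools -/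

section Tools

variable {G : Type*} [Group G] [TopologicalSpace G] [CompactSpace G]
variable {A : Type*} [NormedField A] {n : ℕ}

/-- **Eigenvalues of a compact-image representation are units**: for a continuous
`ρ : G → GL_n(A)` of a compact group over a normed field, every root `μ` of `charpoly ρ(g)` has
`‖μ‖ = 1` (the tree's `FramedRep.norm_le_one_of_isRoot_charpoly` gives `≤ 1`; apply it also to
`g⁻¹`, whose matrix has the eigenvector of `μ` with eigenvalue `μ⁻¹`). Serre 1968, Ch. I §1.1.
[folklore] -/
theorem norm_eq_one_of_isRoot_charpoly (ρ : FramedRep G A n) (g : G) {μ : A}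
    (hμ : (FramedRep.charpoly ρ g).IsRoot μ) : ‖μ‖ = 1 := by
  refine le_antisymm (FramedRep.norm_le_one_of_isRoot_charpoly ρ g hμ) ?_
  set M : Matrix (Fin n) (Fin n) A := ((ρ g : GL (Fin n) A) : Matrix (Fin n) (Fin n) A) with hM
  set M' : Matrix (Fin n) (Fin n) A := ((ρ g⁻¹ : GL (Fin n) A) : Matrix (Fin n) (Fin n) A) with hM'
  have hM'M : M' * M = 1 := by
    rw [hM, hM', map_inv, ← Units.val_mul, inv_mul_cancel, Units.val_one]
  have hev : Module.End.HasEigenvalue (Matrix.toLin' M) μ := by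
    rw [Module.End.hasEigenvalue_iff_isRoot_charpoly, Matrix.charpoly_toLin']
    exact hμ
  obtain ⟨v, hv⟩ := hev.exists_hasEigenvector
  have hv0 : v ≠ 0 := hv.2
  have hMv : M *ᵥ v = μ • v := by
    have h := hv.apply_eq_smul
    rwa [Matrix.toLin'_apply] at h
  have hback : M' *ᵥ (M *ᵥ v) = v := by
    rw [Matrix.mulVec_mulVec, hM'M, Matrix.one_mulVec]
  have hμ0 : μ ≠ 0 := by
    intro h0
    apply hv0
    rw [← hback, hMv, h0, zero_smul, Matrix.mulVec_zero]
  have hM'v : M' *ᵥ v = μ⁻¹ • v := by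
    rw [hMv, Matrix.mulVec_smul] at hback
    calc M' *ᵥ v = μ⁻¹ • (μ • (M' *ᵥ v)) := by rw [smul_smul, inv_mul_cancel₀ hμ0, one_smul]
      _ = μ⁻¹ • v := by rw [hback]
  have hev' : Module.End.HasEigenvalue (Matrix.toLin' M') μ⁻¹ :=
    Module.End.hasEigenvalue_of_hasEigenvector
      ⟨Module.End.mem_eigenspace_iff.mpr (by rw [Matrix.toLin'_apply, hM'v]), hv0⟩
  have hroot' : (FramedRep.charpoly ρ g⁻¹).IsRoot μ⁻¹ := by
    rw [Module.End.hasEigenvalue_iff_isRoot_charpoly, Matrix.charpoly_toLin'] at hev'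
    exact hev'
  have h1 := FramedRep.norm_le_one_of_isRoot_charpoly ρ g⁻¹ hroot'
  rw [norm_inv] at h1
  exact (inv_le_one₀ (norm_pos_iff.mpr hμ0)).mp h1

end Tools

section AutC

/-- **`Aut(ℂ)` is transitive on transcendental numbers**: for `x, y ∈ ℂ` transcendental over `ℚ`
there is a field automorphism `τ` of `ℂ` with `τ x = y` (both give embeddings `ℚ(X) ↪ ℂ` of the
countable field `ℚ(X)`; the tree's `ZarhinLie.exists_ringEquiv_complex_comp_eq` conjugates them).
Bourbaki, Algèbre V §14 no. 6 Cor. 2. [folklore] -/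
theorem exists_ringEquiv_complex_apply_eq {x y : ℂ} (hx : Transcendental ℚ x)
    (hy : Transcendental ℚ y) : ∃ τ : ℂ ≃+* ℂ, τ x = y := by
  haveI : Countable ℚ[X] := Cardinal.mk_le_aleph0_iff.mp
    (Polynomial.cardinalMk_le_max.trans (by rw [Cardinal.mk_eq_aleph0, max_self]))
  haveI : Countable (RatFunc ℚ) :=
    Function.Surjective.countable (f := fun pq : ℚ[X] × ℚ[X] =>
      algebraMap ℚ[X] (RatFunc ℚ) pq.1 / algebraMap ℚ[X] (RatFunc ℚ) pq.2)
      fun f => ⟨(f.num, f.denom), RatFunc.num_div_denom f⟩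
  have emb : ∀ z : ℂ, Transcendental ℚ z → ∃ σ : RatFunc ℚ →+* ℂ, σ RatFunc.X = z := by
    intro z hz
    have hinj : Function.Injective (Polynomial.aeval (R := ℚ) z) :=
      transcendental_iff_injective.mp hz
    have hφ : nonZeroDivisors ℚ[X] ≤
        (nonZeroDivisors ℂ).comap ((Polynomial.aeval (R := ℚ) z).toRingHom) := by
      intro p hp
      rw [Submonoid.mem_comap]
      refine mem_nonZeroDivisors_of_ne_zero fun h0 => nonZeroDivisors.ne_zero hp (hinj ?_)
      rw [map_zero]
      exact h0
    refine ⟨RatFunc.liftRingHom _ hφ, ?_⟩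
    rw [RatFunc.liftRingHom_X]
    simp
  obtain ⟨σ₀, h₀⟩ := emb x hx
  obtain ⟨σ₁, h₁⟩ := emb y hy
  obtain ⟨τ, hτ⟩ :=
    Literature.AlgebraicGeometry.Motives.ZarhinLie.exists_ringEquiv_complex_comp_eq σ₀ σ₁
  exact ⟨τ, by rw [← h₀, hτ, h₁]⟩

/-- `‖ℓ‖ < 1` in `ℚ̄_ℓ` (Mathlib `PadicAlgCl.valuation_p`). [folklore] -/
theorem norm_natCast_padicAlgCl_lt_one (ℓ : ℕ) [Fact ℓ.Prime] : ‖(ℓ : PadicAlgCl ℓ)‖ < 1 := by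
  have h : ‖(ℓ : PadicAlgCl ℓ)‖₊ = 1 / (ℓ : NNReal) := by
    rw [← PadicAlgCl.valuation_def]; exact PadicAlgCl.valuation_p ℓ
  have hℓ : (1 : NNReal) < ℓ := by exact_mod_cast (Fact.out : ℓ.Prime).one_lt
  have : ‖(ℓ : PadicAlgCl ℓ)‖₊ < 1 := by
    rw [h, one_div]; exact inv_lt_one_of_one_lt₀ hℓ
  exact_mod_cast this

/-- **A complex number all of whose `ι`-preimages in `ℚ̄_ℓ` are `ℓ`-adic units is algebraic**:
if `x` were transcendental, so would be `ℓ x`, an automorphism `τ` of `ℂ` with `τ (ℓ x) = x`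
exists (`exists_ringEquiv_complex_apply_eq`), and for `ι' = τ ∘ ι` one gets
`ι'⁻¹(x) = ℓ · ι⁻¹(x)`, of norm `ℓ⁻¹ ≠ 1`. [folklore] -/
theorem isAlgebraic_of_forall_norm_symm_eq_one {ℓ : ℕ} [Fact ℓ.Prime] {x : ℂ}
    (h : ∀ ι : PadicAlgCl ℓ ≃+* ℂ, ‖ι.symm x‖ = 1) : IsAlgebraic ℚ x := by
  by_contra hx
  have hℓ0 : (ℓ : ℂ) ≠ 0 := Nat.cast_ne_zero.mpr (Fact.out : ℓ.Prime).ne_zero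
  have hℓalg : IsAlgebraic ℚ (ℓ : ℂ) := by
    simpa using isAlgebraic_algebraMap (R := ℚ) (A := ℂ) (ℓ : ℚ)
  have hℓx : Transcendental ℚ ((ℓ : ℂ) * x) := fun halg =>
    hx (IsAlgebraic.of_mul (mem_nonZeroDivisors_of_ne_zero hℓ0) hℓalg halg)
  obtain ⟨τ, hτ⟩ := exists_ringEquiv_complex_apply_eq hℓx hx
  obtain ⟨ι⟩ := PadicAlgCl.nonempty_ringEquiv_complex ℓ
  have h1 := h ι
  have h2 := h (ι.trans τ)
  have e : (ι.trans τ).symm x = (ℓ : PadicAlgCl ℓ) * ι.symm x := by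
    have hτ' : τ.symm x = (ℓ : ℂ) * x := by rw [RingEquiv.symm_apply_eq]; exact hτ.symm
    change ι.symm (τ.symm x) = _
    rw [hτ', map_mul, map_natCast]
  rw [e, norm_mul, h1, mul_one] at h2
  exact (norm_natCast_padicAlgCl_lt_one ℓ).ne h2

/-- `√q` (as a complex number) is algebraic over `ℚ`, and so are its powers. [folklore] -/
theorem isAlgebraic_sqrt_pow (q e : ℕ) : IsAlgebraic ℚ ((((Real.sqrt q : ℝ)) : ℂ) ^ e) := by
  refine IsAlgebraic.pow ?_ e
  refine ⟨X ^ 2 - C (q : ℚ), ?_, ?_⟩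
  · intro h0
    have := congrArg (fun P : ℚ[X] => P.coeff 2) h0
    simp [coeff_X_pow] at this
  · have hsq : (((Real.sqrt q : ℝ)) : ℂ) ^ 2 = (q : ℂ) := by
      rw [← Complex.ofReal_pow, Real.sq_sqrt (Nat.cast_nonneg q)]; simp
    simp [hsq]

end AutC

/-- Two Frobenius characteristic polynomials of one framed representation at one place of a number
field coincide (a prime above `u` exists and carries an arithmetic Frobenius: tree theorems
`HeightOneSpectrum.primesAbove_nonempty`, `exists_isArithFrobAt_of_mem_primesAbove_holds`).
[folklore] -/
theorem hasFrobCharpolyAt_unique {K : Type} [Field K] [NumberField K] {A : Type*} [CommRing A]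
    [TopologicalSpace A] {n : ℕ} (r : FramedGaloisRep K A n) {u : HeightOneSpectrum (𝓞 K)}
    {P Q : A[X]} (hP : r.HasFrobCharpolyAt u P) (hQ : r.HasFrobCharpolyAt u Q) : P = Q := by
  obtain ⟨𝔓, h𝔓⟩ := HeightOneSpectrum.primesAbove_nonempty u
  obtain ⟨φ, hφ⟩ := HeightOneSpectrum.exists_isArithFrobAt_of_mem_primesAbove_holds h𝔓
  rw [← hP 𝔓 h𝔓 φ hφ, ← hQ 𝔓 h𝔓 φ hφ]


/-! ## The three consequences of the crux -/

/-- **The crux implies Satake rigidity (multiplicity one) on its control set**: for `σ` as in the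
crux, at a controlled place `u` two base-change Satake parameters of `σ` coincide as multisets.
Proof: instantiate the crux at some `ι` (`PadicAlgCl.nonempty_ringEquiv_complex`); both predicted
polynomials are Frobenius polynomials of the same `r` at `u` (`hasFrobCharpolyAt_unique`), and
`arithFrobPolyOfSatake ι q N` is injective (`arithFrobPolyOfSatake_injective`, `q_u > 0`). [folklore] -/
theorem galoisRepOfUnitaryLDS_satakeRigidity (h : GaloisRepOfUnitaryLDS) :
    ∀ (F₀ K : Type) [Field F₀] [NumberField F₀] [Field K] [NumberField K] [Algebra F₀ K]
      (cK : K ≃ₐ[F₀] K), IsTotallyReal F₀ → Module.finrank F₀ K = 2 → ∀ (hc : cK ≠ 1),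
      IsTotallyComplex K → ∀ (N : ℕ) (ℓ : ℕ) [Fact ℓ.Prime]
      (hcptK : isCompact_glFiniteIntegralLevel N K)
      (σ : UnitaryGroup.CuspidalAutomorphicRepData F₀ K cK N hcptK),
      (∀ (w : {w : InfinitePlace K // w.IsComplex}) (hw : cK • w.1 = w.1),
        ∃ (p q : ℕ) (d : LDSDatum p q),
          UnitaryGroup.IsNondegenerateLimitOfDiscreteSeriesAt F₀ K cK N (StdForm.antidiagonal N)
            hcptK σ.1 hw hc d) →
      (∀ u : HeightOneSpectrum (𝓞 K), ((ℓ : ℕ) : 𝓞 K) ∈ u.asIdeal →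
        u.asIdeal.ramificationIdx ℤ = 1 ∧ UnitaryGroup.IsUnramifiedAt F₀ K cK N hcptK σ.1 u) →
      ∀ (u : HeightOneSpectrum (𝓞 K)) (β₁ β₂ : Multiset ℂ), ((ℓ : ℕ) : 𝓞 K) ∉ u.asIdeal →
        (∀ u' : HeightOneSpectrum (𝓞 K), u'.asIdeal.under ℤ = u.asIdeal.under ℤ →
          u'.asIdeal.ramificationIdx ℤ = 1 ∧ UnitaryGroup.IsUnramifiedAt F₀ K cK N hcptK σ.1 u') →
        UnitaryGroup.HasBaseChangeSatakeAt F₀ K cK N hcptK σ.1 u β₁ →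
        UnitaryGroup.HasBaseChangeSatakeAt F₀ K cK N hcptK σ.1 u β₂ → β₁ = β₂ := by
  intro F₀ K _ _ _ _ _ cK hF₀ hK hc hKc N ℓ _ hcptK σ hLDS hℓ u β₁ β₂ hu hu' h₁ h₂
  obtain ⟨ι⟩ := PadicAlgCl.nonempty_ringEquiv_complex ℓ
  obtain ⟨r, -, hr⟩ := h F₀ K cK hF₀ hK hc hKc N ℓ ι hcptK σ hLDS hℓ
  have e := hasFrobCharpolyAt_unique r (hr u β₁ hu hu' h₁).2 (hr u β₂ hu hu' h₂).2
  exact arithFrobPolyOfSatake_injective ι (zero_lt_one.trans u.one_lt_residueCard) N e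

/-- Refutation shape of rigidity: a cuspidal non-degenerate-LDS `σ`, hyperspecial-unramified above an
unramified `ℓ`, with TWO DISTINCT base-change Satake multisets at one controlled place refutes the
crux as typed.  (No such `σ` exists among genuine automorphic representations — Satake isomorphism
+ irreducibility — and none is constructible over the tree's honest interface; recorded so that
later seats do not re-derive where a counterexample would have to live.) [folklore] -/
theorem galoisRepOfUnitaryLDS_false_of_satakeAmbiguity
    (hex : ∃ (F₀ K : Type) (_ : Field F₀) (_ : NumberField F₀) (_ : Field K) (_ : NumberField K)
      (_ : Algebra F₀ K) (cK : K ≃ₐ[F₀] K) (_ : IsTotallyReal F₀) (_ : Module.finrank F₀ K = 2)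
      (hc : cK ≠ 1) (_ : IsTotallyComplex K) (N ℓ : ℕ) (_ : Fact ℓ.Prime)
      (hcptK : isCompact_glFiniteIntegralLevel N K)
      (σ : UnitaryGroup.CuspidalAutomorphicRepData F₀ K cK N hcptK),
      (∀ (w : {w : InfinitePlace K // w.IsComplex}) (hw : cK • w.1 = w.1),
        ∃ (p q : ℕ) (d : LDSDatum p q),
          UnitaryGroup.IsNondegenerateLimitOfDiscreteSeriesAt F₀ K cK N (StdForm.antidiagonal N)
            hcptK σ.1 hw hc d) ∧
      (∀ u : HeightOneSpectrum (𝓞 K), ((ℓ : ℕ) : 𝓞 K) ∈ u.asIdeal →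
        u.asIdeal.ramificationIdx ℤ = 1 ∧ UnitaryGroup.IsUnramifiedAt F₀ K cK N hcptK σ.1 u) ∧
      ∃ (u : HeightOneSpectrum (𝓞 K)) (β₁ β₂ : Multiset ℂ), ((ℓ : ℕ) : 𝓞 K) ∉ u.asIdeal ∧
        (∀ u' : HeightOneSpectrum (𝓞 K), u'.asIdeal.under ℤ = u.asIdeal.under ℤ →
          u'.asIdeal.ramificationIdx ℤ = 1 ∧ UnitaryGroup.IsUnramifiedAt F₀ K cK N hcptK σ.1 u') ∧
        UnitaryGroup.HasBaseChangeSatakeAt F₀ K cK N hcptK σ.1 u β₁ ∧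
        UnitaryGroup.HasBaseChangeSatakeAt F₀ K cK N hcptK σ.1 u β₂ ∧ β₁ ≠ β₂) :
    ¬ GaloisRepOfUnitaryLDS := by
  intro h
  obtain ⟨F₀, K, _, _, _, _, _, cK, hF₀, hK, hc, hKc, N, ℓ, _, hcptK, σ, hLDS, hℓ, u, β₁, β₂, hu,
    hu', h₁, h₂, hne⟩ := hex
  exact hne (galoisRepOfUnitaryLDS_satakeRigidity h F₀ K cK hF₀ hK hc hKc N ℓ hcptK σ hLDS hℓ u
    β₁ β₂ hu hu' h₁ h₂)

/-- **The crux implies `ℓ`-adic unitarity of the normalised base-change parameters, for EVERY `ι`**: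
for `σ` as in the crux, a controlled `u`, a base-change parameter `β` at `u` and `b ∈ β`,
`‖ι⁻¹(q_u^{(N-1)/2} b)‖ = 1` in `ℚ̄_ℓ`.  Proof: `ι⁻¹((q^{(N-1)/2} b)⁻¹)` is a root of the
characteristic polynomial of `r(Frob_u)` (`roots_arithFrobPolyOfSatake`), i.e. an eigenvalue of a
compact-image representation (`Γ_K` is compact, `absoluteGaloisGroup_compactSpace`), hence a unit
(`norm_eq_one_of_isRoot_charpoly`). [folklore] -/
theorem galoisRepOfUnitaryLDS_satakeIntegrality (h : GaloisRepOfUnitaryLDS) :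
    ∀ (F₀ K : Type) [Field F₀] [NumberField F₀] [Field K] [NumberField K] [Algebra F₀ K]
      (cK : K ≃ₐ[F₀] K), IsTotallyReal F₀ → Module.finrank F₀ K = 2 → ∀ (hc : cK ≠ 1),
      IsTotallyComplex K → ∀ (N : ℕ) (ℓ : ℕ) [Fact ℓ.Prime] (ι : PadicAlgCl ℓ ≃+* ℂ)
      (hcptK : isCompact_glFiniteIntegralLevel N K)
      (σ : UnitaryGroup.CuspidalAutomorphicRepData F₀ K cK N hcptK),
      (∀ (w : {w : InfinitePlace K // w.IsComplex}) (hw : cK • w.1 = w.1),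
        ∃ (p q : ℕ) (d : LDSDatum p q),
          UnitaryGroup.IsNondegenerateLimitOfDiscreteSeriesAt F₀ K cK N (StdForm.antidiagonal N)
            hcptK σ.1 hw hc d) →
      (∀ u : HeightOneSpectrum (𝓞 K), ((ℓ : ℕ) : 𝓞 K) ∈ u.asIdeal →
        u.asIdeal.ramificationIdx ℤ = 1 ∧ UnitaryGroup.IsUnramifiedAt F₀ K cK N hcptK σ.1 u) →
      ∀ (u : HeightOneSpectrum (𝓞 K)) (β : Multiset ℂ), ((ℓ : ℕ) : 𝓞 K) ∉ u.asIdeal →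
        (∀ u' : HeightOneSpectrum (𝓞 K), u'.asIdeal.under ℤ = u.asIdeal.under ℤ →
          u'.asIdeal.ramificationIdx ℤ = 1 ∧ UnitaryGroup.IsUnramifiedAt F₀ K cK N hcptK σ.1 u') →
        UnitaryGroup.HasBaseChangeSatakeAt F₀ K cK N hcptK σ.1 u β →
        ∀ b ∈ β, ‖ι.symm ((((Real.sqrt (u.residueCard : ℝ) : ℝ)) : ℂ) ^ (N - 1) * b)‖ = 1 := by
  intro F₀ K _ _ _ _ _ cK hF₀ hK hc hKc N ℓ _ ι hcptK σ hLDS hℓ u β hu hu' hβ b hb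
  obtain ⟨r, -, hr⟩ := h F₀ K cK hF₀ hK hc hKc N ℓ ι hcptK σ hLDS hℓ
  obtain ⟨𝔓, h𝔓⟩ := HeightOneSpectrum.primesAbove_nonempty u
  obtain ⟨φ, hφ⟩ := HeightOneSpectrum.exists_isArithFrobAt_of_mem_primesAbove_holds h𝔓
  have hchar : FramedRep.charpoly r φ = arithFrobPolyOfSatake ι u.residueCard N β :=
    (hr u β hu hu' hβ).2 𝔓 h𝔓 φ hφ
  set c : ℂ := (((Real.sqrt (u.residueCard : ℝ) : ℝ)) : ℂ) ^ (N - 1) with hc_def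
  have hmem : ι.symm (c * b)⁻¹ ∈ (FramedRep.charpoly r φ).roots := by
    rw [hchar, roots_arithFrobPolyOfSatake]
    exact Multiset.mem_map_of_mem _ hb
  have hroot : (FramedRep.charpoly r φ).IsRoot (ι.symm (c * b)⁻¹) := isRoot_of_mem_roots hmem
  haveI : CompactSpace (Field.absoluteGaloisGroup K) := absoluteGaloisGroup_compactSpace K
  have h1 := norm_eq_one_of_isRoot_charpoly r φ hroot
  rwa [map_inv₀, norm_inv, inv_eq_one] at h1

/-- **The crux implies algebraicity of the base-change Satake parameters on its control set**: for
`σ` as in the crux, a controlled `u` and a base-change parameter `β` of `σ` at `u`, every `b ∈ β` is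
algebraic over `ℚ`.  Proof: by `galoisRepOfUnitaryLDS_satakeIntegrality`, `x = q^{(N-1)/2} b` has
`‖ι⁻¹ x‖ = 1` for EVERY `ι`, so `x` is algebraic (`isAlgebraic_of_forall_norm_symm_eq_one`), and
`q^{(N-1)/2}` is a non-zero algebraic number (`isAlgebraic_sqrt_pow`, `sqrt_residueCard_ne_zero`).
In print: Goldring–Koskivirta 2019 Cor. 2.2.2 with Harris' rational structure — the crux is at
least as strong as the algebraicity of Hecke eigenvalues of non-degenerate-LDS cusp forms.
[folklore] -/
theorem galoisRepOfUnitaryLDS_satakeAlgebraicity (h : GaloisRepOfUnitaryLDS) :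
    ∀ (F₀ K : Type) [Field F₀] [NumberField F₀] [Field K] [NumberField K] [Algebra F₀ K]
      (cK : K ≃ₐ[F₀] K), IsTotallyReal F₀ → Module.finrank F₀ K = 2 → ∀ (hc : cK ≠ 1),
      IsTotallyComplex K → ∀ (N : ℕ) (ℓ : ℕ) [Fact ℓ.Prime]
      (hcptK : isCompact_glFiniteIntegralLevel N K)
      (σ : UnitaryGroup.CuspidalAutomorphicRepData F₀ K cK N hcptK),
      (∀ (w : {w : InfinitePlace K // w.IsComplex}) (hw : cK • w.1 = w.1),
        ∃ (p q : ℕ) (d : LDSDatum p q),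
          UnitaryGroup.IsNondegenerateLimitOfDiscreteSeriesAt F₀ K cK N (StdForm.antidiagonal N)
            hcptK σ.1 hw hc d) →
      (∀ u : HeightOneSpectrum (𝓞 K), ((ℓ : ℕ) : 𝓞 K) ∈ u.asIdeal →
        u.asIdeal.ramificationIdx ℤ = 1 ∧ UnitaryGroup.IsUnramifiedAt F₀ K cK N hcptK σ.1 u) →
      ∀ (u : HeightOneSpectrum (𝓞 K)) (β : Multiset ℂ), ((ℓ : ℕ) : 𝓞 K) ∉ u.asIdeal →
        (∀ u' : HeightOneSpectrum (𝓞 K), u'.asIdeal.under ℤ = u.asIdeal.under ℤ →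
          u'.asIdeal.ramificationIdx ℤ = 1 ∧ UnitaryGroup.IsUnramifiedAt F₀ K cK N hcptK σ.1 u') →
        UnitaryGroup.HasBaseChangeSatakeAt F₀ K cK N hcptK σ.1 u β → ∀ b ∈ β, IsAlgebraic ℚ b := by
  intro F₀ K _ _ _ _ _ cK hF₀ hK hc hKc N ℓ _ hcptK σ hLDS hℓ u β hu hu' hβ b hb
  set c : ℂ := (((Real.sqrt (u.residueCard : ℝ) : ℝ)) : ℂ) ^ (N - 1) with hc_def
  have hx : IsAlgebraic ℚ (c * b) := isAlgebraic_of_forall_norm_symm_eq_one (ℓ := ℓ) fun ι ↦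
    galoisRepOfUnitaryLDS_satakeIntegrality h F₀ K cK hF₀ hK hc hKc N ℓ ι hcptK σ hLDS hℓ u β hu
      hu' hβ b hb
  have hc0 : c ≠ 0 := pow_ne_zero _ (sqrt_residueCard_ne_zero u)
  exact IsAlgebraic.of_mul (mem_nonZeroDivisors_of_ne_zero hc0) (isAlgebraic_sqrt_pow _ _) hx

/-- Refutation shape of algebraicity: ONE transcendental base-change Satake entry of ONE cuspidal
non-degenerate-LDS `σ` (hyperspecial-unramified above an unramified `ℓ`) at ONE controlled place
refutes the crux as typed.  (Expected impossible for genuine `σ` — this is the content of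
Goldring–Koskivirta Cor. 2.2.2 — and no `σ` is constructible over the tree's honest interface.)
[folklore] -/
theorem galoisRepOfUnitaryLDS_false_of_transcendentalSatake
    (hex : ∃ (F₀ K : Type) (_ : Field F₀) (_ : NumberField F₀) (_ : Field K) (_ : NumberField K)
      (_ : Algebra F₀ K) (cK : K ≃ₐ[F₀] K) (_ : IsTotallyReal F₀) (_ : Module.finrank F₀ K = 2)
      (hc : cK ≠ 1) (_ : IsTotallyComplex K) (N ℓ : ℕ) (_ : Fact ℓ.Prime)
      (hcptK : isCompact_glFiniteIntegralLevel N K)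
      (σ : UnitaryGroup.CuspidalAutomorphicRepData F₀ K cK N hcptK),
      (∀ (w : {w : InfinitePlace K // w.IsComplex}) (hw : cK • w.1 = w.1),
        ∃ (p q : ℕ) (d : LDSDatum p q),
          UnitaryGroup.IsNondegenerateLimitOfDiscreteSeriesAt F₀ K cK N (StdForm.antidiagonal N)
            hcptK σ.1 hw hc d) ∧
      (∀ u : HeightOneSpectrum (𝓞 K), ((ℓ : ℕ) : 𝓞 K) ∈ u.asIdeal →
        u.asIdeal.ramificationIdx ℤ = 1 ∧ UnitaryGroup.IsUnramifiedAt F₀ K cK N hcptK σ.1 u) ∧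
      ∃ (u : HeightOneSpectrum (𝓞 K)) (β : Multiset ℂ) (b : ℂ), ((ℓ : ℕ) : 𝓞 K) ∉ u.asIdeal ∧
        (∀ u' : HeightOneSpectrum (𝓞 K), u'.asIdeal.under ℤ = u.asIdeal.under ℤ →
          u'.asIdeal.ramificationIdx ℤ = 1 ∧ UnitaryGroup.IsUnramifiedAt F₀ K cK N hcptK σ.1 u') ∧
        UnitaryGroup.HasBaseChangeSatakeAt F₀ K cK N hcptK σ.1 u β ∧ b ∈ β ∧ Transcendental ℚ b) :
    ¬ GaloisRepOfUnitaryLDS := by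
  intro h
  obtain ⟨F₀, K, _, _, _, _, _, cK, hF₀, hK, hc, hKc, N, ℓ, _, hcptK, σ, hLDS, hℓ, u, β, b, hu,
    hu', hβ, hb, htr⟩ := hex
  exact htr (galoisRepOfUnitaryLDS_satakeAlgebraicity h F₀ K cK hF₀ hK hc hKc N ℓ hcptK σ hLDS hℓ
    u β hu hu' hβ b hb)

end Summit.Langlands.Langlands.Theorems.GaloisRepOfUnitaryLDS.Negative

end
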